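import Literature.NumberTheory.Automorphic.AsaiSignContProofsL2
import Literature.NumberTheory.Automorphic.CuspidalDescentCyclicRepData
import Literature.NumberTheory.Automorphic.PairLFunctionMeromorphicContinuationNeConjProofs
import Literature.NumberTheory.Automorphic.ArthurClozelCuspidalDescentAssembly
import HarnessLib

/-!
# Grbac–Shahidi 2015, Thm. 4.3 at `s = 1`: the Rankin–Selberg input from the `L²` facts of
# Jacquet–Shalika (Galois conjugation in `L²_cusp`), and the fact from holomorphy alone

Topic `NumberTheory/Automorphic`; namespace `Literature.NumberTheory.Automorphic`. Proof file
(theorems only: no definition, no named fact, no instance), third sibling of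
`AsaiSignContinuation` (the named fact `GrbacShahidi2015_partialAsaiL_at_one`), continuing
`AsaiAtOneOfHolomorphy` (`GrbacShahidi2015_partialAsaiL_at_one_of_holomorphy`: the fact from the
holomorphy hypothesis `hHol` and a Rankin–Selberg hypothesis `hRS` for the pair `(Π, Π^c)` at every
Asai datum) in the manner of `AsaiSignContProofsL2` (which did the same service for Mok's dichotomy
in the conjugate self-dual case).

## What is proved

The Rankin–Selberg hypothesis `hRS` of `GrbacShahidi2015_partialAsaiL_at_one_of_holomorphy` — for a
unitary cuspidal `Π` on `GL_N(𝔸_E)` and an Asai datum `(S, A)`: the raw product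
`R(s) = L^{S_E}(s, A ⊗ A^c)` is multipliable and holomorphic on `{1 < Re s}`, with a simple pole at
`s = 1` along `Re s → 1⁺` if `Π` is conjugate self-dual and a finite non-zero limit otherwise
(Grbac–Shahidi 2015, p. 206: "The poles of the Rankin–Selberg `L`-function `L(s, σ × σ^θ)` are
known from [Jacquet and Shalika 1981]"; Arthur–Clozel, Ch. 3, (2.1)–(2.3)) — was kept as a
hypothesis there "for want of the Galois-conjugate Borel–Jacquet datum `Π^c`". Here it is DERIVED,
at all sufficiently large Asai data of `Π`, from the tree's `L²` named facts

* `JacquetShalika1981_partialPairL_pole_of_eq_conj` ((2.3): simple pole of `L^S(s, π ⊗ π̄)` at `1`),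
* `JacquetShalika1981_partialPairL_at_one_of_ne_conj` ((2.2) at `s₀ = 1` for `π ≇ σ̃`, read
  through `multiplicity_one_gl`),
* `JacquetShalika1981_partialPairL_boundary_of_ne_one` ((2.2) at `s₀ ≠ 1` on `Re s = 1`),

WITHOUT any datum `Π^c`: the Galois conjugate is taken in `L²_cusp` instead
(`CuspidalAutomorphicRepGL.galConj`, `IsSatakeFamilyOf.galConj`: `t_{U_c(Π₀), w} = t_{Π₀, c w}`;
every automorphic measure is `Gal(E/F)`-invariant, `isGalInvariant_of_unique`,
`isAutomorphicMeasure_unique_smul_holds`). Namely (`exists_largeSet_pairL_finite_of_L2`), for `Π`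
NOT conjugate self-dual a.e.: `t_{Π,w} = q_w^z t_{Π₀,w}` off a finite `S₁` for a cuspidal
`Π₀ ≤ L²_cusp` (Borel–Jacquet 5.7, `exists_satake_eq_cpow_mul_L2_holds`), `Re z = 0` by unitarity at
one place, so that `L^{S_E}(s, A ⊗ A^c) = L^{S_E}(s - 2z, Π₀ × Π₀^c)` as soon as `S` contains the
places below `S₁` (the conjugate places `c S₁` lie over the same places of `F`); for `z ≠ 0` the
boundary point `1 - 2z ≠ 1` of `Re s = 1` is outside `X` ((2.2), `…_boundary_of_ne_one`), and for
`z = 0` the hypothesis gives `Π₀ ≠ \overline{Π₀^c}` — else `t_{Π₀,w} = \bar t_{Π₀, cw}`, i.e.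
`t_{Π, cw} = \bar t_{Π,w} = t_{Π,w}⁻¹` off `S_E` (`t⁻¹ = t̄` for `L²` families,
`HasSatakeParameterAt.map_conj_inv_eq`), which is conjugate self-duality a.e. — so (2.2) at
`s₀ = 1` (`…_at_one_of_ne_conj`) applies. For `Π` conjugate self-dual a.e. the argument of
`AsaiSignContProofsL2` (`t_{Π, cw} = t_{Π,w}⁻¹ = q^{-z} \bar t_{Π₀,w}`, pair `(Π₀, Π̄₀)`, (2.3)) is
repeated with holomorphy on `{1 < Re s}` taken from Jacquet–Shalika's Thm. (5.3) (the theorem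
`differentiableOn_partialPairL_of_isSatakeFamilyOf`) instead of Mœglin–Waldspurger
(`exists_largeSet_pairL_pole_of_L2'`). Multipliability on `{1 < Re s}` is (2.1), the theorem
`JacquetShalika1981_multipliable_partialPairL_holds`.

For an ARBITRARY Asai datum `(S, A)` the `s = 1` clause of the fact is then obtained at the enlarged
datum `(S ∪ S⋆, A)` and transported DOWN to `S` (`exists_clause_of_eq_mul`): far to the right
`L^{S ∪ S⋆} = Q · L^S` with `Q(s) = ∏_{v ∈ S⋆ ∖ S} det(1 - As^η(t_v) q_v^{-s})` entire
(`exists_forall_partialAsaiL_eq_prod_mul`), so `(s - 1) L^{S ∪ S⋆}` continues as `Q · G` for the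
continuation `G` of `(s - 1) L^S` given by `hHol`; a continued pole (`G''(1) ≠ 0`) or a zero of `Q`
at `1` leaves `G(1) ≠ 0` (clause with `k = 1`), and otherwise `dslope G 1 = G/(s - 1)` continues
`L^S` with `Q(1) · G'(1) = G''(1) ≠ 0` (clause with `k = 0`). Unlike the datum-independence of the
SIGN in Mok's dichotomy (`AsaiSignContProofsL2`, hypothesis `hNV`), this needs NO non-vanishing of
the removed unramified factors at `s = 1`: the fact only asserts "at most a simple pole, and a
non-zero leading value" at each datum separately.

Results:

* `GrbacShahidi2015_partialAsaiL_at_one_of_holomorphy_of_L2` — **the named fact follows from the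
  holomorphy hypothesis `hHol` of `AsaiAtOneOfHolomorphy` (Grbac–Shahidi, Thm. 4.3 (1) and (2)(a),
  holomorphy clauses at `s = 1`, partial form) and the three `L²` named facts of Jacquet–Shalika
  with `multiplicity_one_gl`** — every hypothesis other than `hHol` being a NAMED FACT of the tree;
* `GrbacShahidi2015_partialAsaiL_at_one_of_Mok_of_L2` — the same with the conjugate self-dual
  stratum of `hHol` fed from `Mok2014_partialAsaiL_continuation_pole_dichotomy`
  (`hol_of_Mok2014_partialAsaiL_continuation_pole_dichotomy`), leaving as the ONLY input that is not
  a declaration of the tree the non-conjugate-self-dual stratum `hHolnc`: for `Π` unitary cuspidal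
  and not conjugate self-dual a.e., `(s - 1) L^S(s, Π, As^η)` continues holomorphically to
  `{1 < Re s} ∪ B(1, δ)` with value `0` at `1` — Grbac–Shahidi, Thm. 4.3 (1) ("`L(s, σ, r_A)` is
  entire"), holomorphy at `s = 1`, for the partial functions (unconditional: Thm. 4.1 (1) rests on
  Harish-Chandra, Mœglin–Waldspurger IV.3.12, Remark 4.2, and Thm. 2.1).

What this does NOT give: `hHol` / `hHolnc` (Langlands–Shahidi theory on `U(n, n)`), the three `L²`
facts (Rankin–Selberg theory) and multiplicity one.

## References

* N. Grbac, F. Shahidi, *Endoscopic transfer for unitary groups and holomorphy of Asai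
  `L`-functions*, Pacific J. Math. 276 (2015), 185–211: Thm. 4.3 (pp. 186, 204) and its proof,
  pp. 204–206 (`(∗∗)`, Remarks 4.2, 4.4). [GrbacShahidi2015]
* J. Arthur, L. Clozel, *Simple algebras, base change, and the advanced theory of the trace formula*,
  Ann. of Math. Stud. 120 (1989), Ch. 1 §2.1 (`Π^σ`), Ch. 3 §2 (2.1)–(2.3). [ArthurClozelAMS120]
* H. Jacquet, J. A. Shalika, *On Euler products and the classification of automorphic
  representations I, II*, Amer. J. Math. 103 (1981): I Thm. (5.3); II Prop. 3.6.
  [JacquetShalikaAJM1981] [JacquetShalikaAJM1981II]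
* A. Borel, H. Jacquet, *Automorphic forms and automorphic representations*, Corvallis 1979, 5.7.
  [BorelJacquetCorvallis1979]
* C. P. Mok, *Endoscopic classification of representations of quasi-split unitary groups*,
  Mem. Amer. Math. Soc. 235 (2015), no. 1108, §2.5. [Mok2014]
-/

noncomputable section

open scoped Topology
open NumberField IsDedekindDomain Filter Polynomial MeasureTheory

namespace Literature.NumberTheory.Automorphic

/-! ### Transport of the `s = 1` clause down a finite enlargement of `S`, abstractly -/

section Analysis

/-- Values at `1` of functions continuous at `1` are limits along `s → 1`, `Re s > 1`; so an identity
valid on `{1 < Re s}` between functions differentiable at `1` holds at `1`. [folklore] -/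
theorem apply_one_eq_of_eqOn_one_lt_re {Φ Ψ : ℂ → ℂ} (hΦ : ContinuousAt Φ 1) (hΨ : ContinuousAt Ψ 1)
    (h : ∀ᶠ s in 𝓝[{s : ℂ | 1 < s.re}] (1 : ℂ), Φ s = Ψ s) : Φ 1 = Ψ 1 :=
  tendsto_nhds_unique (hΦ.tendsto.mono_left nhdsWithin_le_nhds)
    ((hΨ.tendsto.mono_left nhdsWithin_le_nhds).congr' (h.mono fun _ hs => hs.symm))

/-- **The `s = 1` clause goes down along `L'' = Q · L` (`Q` entire).** Let `G` continue `(s - 1) L`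
to `{1 < Re s} ∪ B(1, δ)` (`G = (s - 1) L` on `{σ < Re s}`, `σ ≥ 1`), let `L'' = Q L` on `{σ < Re s}`
with `Q` entire, and suppose the clause of `GrbacShahidi2015_partialAsaiL_at_one` holds for `L''`:
`G'' = (s - 1)^{k''} L''` on `{σ < Re s}`, `k'' ≤ 1`, `G''` holomorphic on `{1 < Re s} ∪ B(1, δ'')`,
`G''(1) ≠ 0`. Then the clause holds for `L`: `(s - 1)^{1 - k''} G'' = Q G` on `{1 < Re s}` (identity
theorem) hence at `1`; if `G(1) ≠ 0` take `k = 1` and `G`; otherwise `k'' = 0`, `G'' = Q · dslope G 1`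
on `{1 < Re s}` and at `1`, so `dslope G 1` continues `L` with `(dslope G 1)(1) ≠ 0`, `k = 0`.
[cite: GrbacShahidi2015, proof of Thm. 4.3, pp. 205–206] -/
theorem exists_clause_of_eq_mul {L L'' Q G G'' : ℂ → ℂ} {σ δ δ'' : ℝ} {k'' : ℕ} (hσ : 1 ≤ σ)
    (hδ : 0 < δ) (hδ'' : 0 < δ'') (hQ : Differentiable ℂ Q)
    (hLL : ∀ s : ℂ, σ < s.re → L'' s = Q s * L s)
    (hG : DifferentiableOn ℂ G ({s : ℂ | 1 < s.re} ∪ Metric.ball (1 : ℂ) δ))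
    (hGL : ∀ s : ℂ, σ < s.re → G s = (s - 1) * L s) (hk'' : k'' ≤ 1)
    (hG'' : DifferentiableOn ℂ G'' ({s : ℂ | 1 < s.re} ∪ Metric.ball (1 : ℂ) δ''))
    (hG''L : ∀ s : ℂ, σ < s.re → G'' s = (s - 1) ^ k'' * L'' s) (hG''1 : G'' 1 ≠ 0) :
    ∃ (k : ℕ) (δ' : ℝ) (G' : ℂ → ℂ), k ≤ 1 ∧ 0 < δ' ∧
      DifferentiableOn ℂ G' ({s : ℂ | 1 < s.re} ∪ Metric.ball 1 δ') ∧
      (∀ s : ℂ, σ < s.re → G' s = (s - 1) ^ k * L s) ∧ G' 1 ≠ 0 := by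
  by_cases hG1 : G 1 ≠ 0
  · exact exists_continuation_of_apply_one_ne_zero hδ hG hGL hG1
  rw [not_not] at hG1
  -- continuity at `1`
  have hU : {s : ℂ | 1 < s.re} ∪ Metric.ball (1 : ℂ) δ ∈ 𝓝 (1 : ℂ) := one_lt_re_union_ball_mem_nhds hδ
  have hU'' : {s : ℂ | 1 < s.re} ∪ Metric.ball (1 : ℂ) δ'' ∈ 𝓝 (1 : ℂ) :=
    one_lt_re_union_ball_mem_nhds hδ''
  have hGc : ContinuousAt G 1 := (hG.differentiableAt hU).continuousAt
  have hG''c : ContinuousAt G'' 1 := (hG''.differentiableAt hU'').continuousAt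
  have hQc : ContinuousAt Q 1 := (hQ 1).continuousAt
  have hHd : DifferentiableOn ℂ (dslope G 1) ({s : ℂ | 1 < s.re} ∪ Metric.ball (1 : ℂ) δ) :=
    differentiableOn_dslope_one hδ hG
  have hHc : ContinuousAt (dslope G 1) 1 := (hHd.differentiableAt hU).continuousAt
  -- restrictions to `{1 < Re s}`
  have hGV : DifferentiableOn ℂ G {s : ℂ | 1 < s.re} := hG.mono Set.subset_union_left
  have hG''V : DifferentiableOn ℂ G'' {s : ℂ | 1 < s.re} := hG''.mono Set.subset_union_left
  have hHV : DifferentiableOn ℂ (dslope G 1) {s : ℂ | 1 < s.re} := hHd.mono Set.subset_union_left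
  have hQV : DifferentiableOn ℂ Q {s : ℂ | 1 < s.re} := hQ.differentiableOn
  -- `dslope G 1 = L` on `{σ < Re s}`
  have hHL : ∀ s : ℂ, σ < s.re → dslope G 1 s = L s := fun s hs =>
    dslope_one_eq_of_eq_sub_one_mul hσ hG1 hGL hs
  rcases Nat.le_one_iff_eq_zero_or_eq_one.mp hk'' with rfl | rfl
  · -- `k'' = 0`: `G'' = L'' = Q L = Q · dslope G 1` on `{σ < Re s}`, hence on `{1 < Re s}` and at `1`
    have hev : ∀ᶠ s in 𝓝[{s : ℂ | 1 < s.re}] (1 : ℂ), G'' s = Q s * dslope G 1 s :=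
      eventually_eq_nhdsWithin_one_of_eq_on_lt_re hσ hG''V (hQV.mul hHV) fun s hs => by
        rw [hG''L s hs, pow_zero, one_mul, hLL s hs, hHL s hs]
    have h1 : G'' 1 = Q 1 * dslope G 1 1 := apply_one_eq_of_eqOn_one_lt_re hG''c (hQc.mul hHc) hev
    have hH1 : dslope G 1 1 ≠ 0 := fun h0 => hG''1 (by rw [h1, h0, mul_zero])
    refine ⟨0, δ, dslope G 1, zero_le_one, hδ, hHd, fun s hs => ?_, hH1⟩
    rw [pow_zero, one_mul, hHL s hs]
  · -- `k'' = 1`: `G'' = (s - 1) L'' = Q G` on `{σ < Re s}`, hence at `1`: `G''(1) = Q(1) G(1) = 0`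
    exfalso
    have hev : ∀ᶠ s in 𝓝[{s : ℂ | 1 < s.re}] (1 : ℂ), G'' s = Q s * G s :=
      eventually_eq_nhdsWithin_one_of_eq_on_lt_re hσ hG''V (hQV.mul hGV) fun s hs => by
        rw [hG''L s hs, pow_one, hLL s hs, hGL s hs]; ring
    have h1 : G'' 1 = Q 1 * G 1 := apply_one_eq_of_eqOn_one_lt_re hG''c (hQc.mul hGc) hev
    exact hG''1 (by rw [h1, hG1, mul_zero])

end Analysis

/-! ### The Rankin–Selberg input at large data, from the `L²` facts -/

section RankinSelberg

open AdelicGroupData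

variable {F E : Type} [Field F] [NumberField F] [Field E] [NumberField E] [Algebra F E]
  {N : ℕ} {hcpt : isCompact_glFiniteIntegralLevel N E}

/-- **`L^{S_E}(s, Π × Π^c)` for `Π` NOT conjugate self-dual: multipliable and holomorphic on
`{1 < Re s}`, finite and non-zero at `s = 1` along `Re s → 1⁺`, at all large Asai data — from the
`L²` facts (2.2) of Jacquet–Shalika and multiplicity one, by Galois conjugation in `L²_cusp`.**
For a quadratic `E/F` with automorphism `c` (only `c² = 1` is used), a cuspidal `Π` on `GL_N(𝔸_E)`,
`N ≥ 1`, unitary a.e. and not conjugate self-dual a.e., granted (2.2) at `s₀ = 1` for `π ≇ σ̃`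
(`h22`, through `multiplicity_one_gl`, `hm1`) and on `Re s = 1` off `1` (`h22'`) for
`L²_cusp(GL_N(𝔸_E))` (every automorphic measure): there is a finite set `S⋆` of places of `F` such
that for every Asai datum `(S, A)` with `S⋆ ⊆ S` the raw product `R(s) = L^{S_E}(s, A ⊗ A^c)` is
multipliable and holomorphic on `{1 < Re s}` and tends to some `r ≠ 0` as `s → 1`, `Re s > 1`.
Proof: `t_{Π,w} = q_w^z t_{Π₀,w}` off `S₁` for a cuspidal `Π₀ ≤ L²_cusp(μ)` (Borel–Jacquet 5.7,
`exists_satake_eq_cpow_mul_L2_holds`), `Re z = 0` by unitarity at one place; `μ` is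
`Gal(E/F)`-invariant (`isGalInvariant_of_unique`), and `w ↦ t_{Π₀, cw}` is a Satake family of the
Galois conjugate `U_c(Π₀)` (`IsSatakeFamilyOf.galConj`); so for `S ⊇ S⋆ :=` the places below `S₁`,
`R(s) = L^{S_E}(s - 2z, Π₀ × U_c(Π₀))` ((2.1) and holomorphy by the theorems
`JacquetShalika1981_multipliable_partialPairL_holds`, `differentiableOn_partialPairL_of_isSatakeFamilyOf`).
If `z ≠ 0`, `h22'` at `1 - 2z ≠ 1`. If `z = 0`, `Π₀ ≠ \overline{U_c(Π₀)}`: otherwise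
`t_{Π₀,w} = \bar t_{Π₀,cw}` off `S_E` (uniqueness of Satake parameters), whence
`A(cw) = A(w)⁻¹` at every `w ∉ S_E` by `(\bar t)⁻¹ = t` for `L²` families
(`HasSatakeParameterAt.map_conj_inv_eq`), which makes `Π` conjugate self-dual a.e.
(`hasSatakeParamAt_unique_holds`); so `h22` applies.
[cite: GrbacShahidi2015, proof of Thm. 4.3, p. 206] [cite: ArthurClozelAMS120, Ch. 3 §2 (2.1)–(2.2)]
[cite: BorelJacquetCorvallis1979, 5.7] -/
theorem CuspidalAutomorphicRepData.exists_largeSet_pairL_finite_of_L2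
    (h22 : ∀ (μ : Measure (gl N E).automorphicQuotient) [(gl N E).IsAutomorphicMeasure μ],
      JacquetShalika1981_partialPairL_at_one_of_ne_conj (n := N) (K := E) (μ := μ))
    (h22' : ∀ (μ : Measure (gl N E).automorphicQuotient) [(gl N E).IsAutomorphicMeasure μ],
      JacquetShalika1981_partialPairL_boundary_of_ne_one (n := N) (m := N) (K := E) (μ := μ)
        (μ' := μ))
    (hm1 : ∀ (μ : Measure (gl N E).automorphicQuotient) [(gl N E).IsAutomorphicMeasure μ],
      multiplicity_one_gl N E μ)
    {c : E ≃ₐ[F] E} (hcc : c * c = 1) (hN : 0 < N) (π : CuspidalAutomorphicRepData N E hcpt)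
    (hu : ∀ᶠ w : HeightOneSpectrum (𝓞 E) in cofinite, ∀ α : Multiset ℂ,
      π.1.HasSatakeParamAt w α → ‖α.prod‖ = 1)
    (hπ : ¬ π.1.IsConjSelfDualAE c) :
    ∃ Sstar : Set (HeightOneSpectrum (𝓞 F)), Sstar.Finite ∧
      ∀ (S : Set (HeightOneSpectrum (𝓞 F))) (A : SatakeFamily E), Sstar ⊆ S →
        π.1.IsAsaiDatum c S A →
        (∀ s : ℂ, 1 < s.re →
          Multipliable fun w : {w : HeightOneSpectrum (𝓞 E) // w.under (𝓞 F) ∉ S} =>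
            ((satakePairPolynomial (A w.1) (A (c • w.1))).eval
              ((w.1.residueCard : ℂ) ^ (-s)))⁻¹) ∧
        DifferentiableOn ℂ
          (partialPairL {w : HeightOneSpectrum (𝓞 E) | w.under (𝓞 F) ∈ S} A (fun w => A (c • w)))
          {s : ℂ | 1 < s.re} ∧
        ∃ r : ℂ, r ≠ 0 ∧
          Tendsto
            (partialPairL {w : HeightOneSpectrum (𝓞 E) | w.under (𝓞 F) ∈ S} A (fun w => A (c • w)))
            (𝓝[{s : ℂ | 1 < s.re}] 1) (𝓝 r) := by
  classical
  haveI : NeZero N := ⟨hN.ne'⟩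
  haveI := infinite_heightOneSpectrum E
  obtain ⟨μ, hμ⟩ := AdelicGroupData.exists_isAutomorphicMeasure_gl_holds (n := N) (K := E)
  haveI := hμ
  have hμG : IsGalInvariant F μ :=
    isGalInvariant_of_unique F (isAutomorphicMeasure_unique_smul_holds N E) μ
  obtain ⟨z, P, S₁, αP, hS₁, hαP, hdict⟩ :=
    CuspidalAutomorphicRepData.exists_satake_eq_cpow_mul_L2_holds μ π
  have hcinv : c⁻¹ = c := inv_eq_of_mul_eq_one_right hcc
  -- the Galois conjugate `U_c(Π₀)` and its Satake family `w ↦ t_{Π₀, c w}`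
  set Pc : CuspidalAutomorphicRepGL N E μ := P.galConj F hμG c with hPc
  have hβ₀ : IsSatakeFamilyOf Pc ((c • ·) ⁻¹' S₁) (fun w => αP (c • w)) := by
    have h := hαP.galConj F hμG c
    rw [hcinv] at h
    exact h
  refine ⟨(fun w : HeightOneSpectrum (𝓞 E) => w.under (𝓞 F)) '' S₁, hS₁.image _,
    fun S A hSstar hSA => ?_⟩
  -- bookkeeping above the complement of `S`
  set SE : Set (HeightOneSpectrum (𝓞 E)) := {w | w.under (𝓞 F) ∈ S} with hSE
  have hSEfin : SE.Finite := finite_setOf_under_mem hSA.finite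
  have hS₁SE : S₁ ⊆ SE := fun w hw => hSstar ⟨w, hw, rfl⟩
  have hcS₁SE : (c • ·) ⁻¹' S₁ ⊆ SE := fun w hw => by
    show w.under (𝓞 F) ∈ S
    rw [← HeightOneSpectrum.under_algEquiv_smul F E c w]
    exact hSstar ⟨c • w, hw, rfl⟩
  have hαSE : IsSatakeFamilyOf P SE αP := hαP.mono hS₁SE
  have hβSE : IsSatakeFamilyOf Pc SE (fun w => αP (c • w)) := hβ₀.mono hcS₁SE
  have hunder : ∀ w : HeightOneSpectrum (𝓞 E), w ∉ SE → w.under (𝓞 F) ∉ S := fun w hw => hw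
  have hunderc : ∀ w : HeightOneSpectrum (𝓞 E), w ∉ SE → (c • w).under (𝓞 F) ∉ S := fun w hw => by
    rw [HeightOneSpectrum.under_algEquiv_smul]
    exact hw
  -- the shift `t_Π = q^z t_{Π₀}` at `w` and at `c w`
  have hα : ∀ w ∉ SE, A w = (αP w).map (((w.residueCard : ℂ) ^ z) * ·) := fun w hw =>
    (hdict w (fun h => hw (hS₁SE h)) (A w)).mp (hSA.hasSatakeParamAt (hunder w hw))
  have hβ : ∀ w ∉ SE, A (c • w) = (αP (c • w)).map (((w.residueCard : ℂ) ^ z) * ·) := by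
    intro w hw
    have hcw : c • w ∉ S₁ := fun h => hw (hcS₁SE h)
    have := (hdict (c • w) hcw (A (c • w))).mp (hSA.hasSatakeParamAt (hunderc w hw))
    rwa [residueCard_smul F c w] at this
  -- `Re z = 0` by unitarity at one place outside `S_E`
  have hz : z.re = 0 := by
    have hev : ∀ᶠ w : HeightOneSpectrum (𝓞 E) in cofinite, w ∉ SE := hSEfin.compl_mem_cofinite
    obtain ⟨w₀, hw₀u, hw₀⟩ := (hu.and hev).exists
    exact re_eq_zero_of_norm_prod_eq_one_of_shift hαSE hN hw₀ (hα w₀ hw₀)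
      (hw₀u (A w₀) (hSA.hasSatakeParamAt (hunder w₀ hw₀)))
  have hzz : (z + z).re = 0 := by rw [Complex.add_re, hz, add_zero]
  have hre : ∀ s : ℂ, (s - (z + z)).re = s.re := fun s => by
    rw [Complex.sub_re, hzz, sub_zero]
  -- `R(s) = L^{S_E}(s - 2z, Π₀ × U_c(Π₀))`
  have hR : partialPairL SE A (fun w => A (c • w)) =
      fun s => partialPairL SE αP (fun w => αP (c • w)) (s - (z + z)) :=
    partialPairL_eq_of_shift hα hβ
  refine ⟨fun s hs => ?_, ?_, ?_⟩
  · -- multipliability on `{1 < Re s}` ((2.1), `JacquetShalika1981_multipliable_partialPairL_holds`)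
    have hs' : 1 < (s - (z + z)).re := by rwa [hre]
    have key := JacquetShalika1981_multipliable_partialPairL_holds P Pc hαSE hβSE hs'
    refine key.congr fun w => ?_
    have h := congrFun (pairEulerFactor_eq_of_shift (β := fun w => A (c • w))
      (β₀ := fun w => αP (c • w)) hα hβ s) w
    exact h.symm
  · -- holomorphy on `{1 < Re s}` (Jacquet–Shalika I, Thm. (5.3))
    rw [hR]
    have hd := differentiableOn_partialPairL_of_isSatakeFamilyOf P Pc hαSE hβSE
    refine hd.comp (differentiable_id.sub_const (z + z)).differentiableOn fun s hs => ?_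
    show 1 < (s - (z + z)).re
    rw [hre]
    exact hs
  · -- the finite non-zero limit at `s = 1` ((2.2))
    by_cases hz0 : z + z = 0
    · -- `z = 0`: `Π₀ ≠ conj (U_c Π₀)` from the failure of conjugate self-duality, then `h22`
      have hz' : z = 0 := add_self_eq_zero.mp hz0
      have hα0 : ∀ w ∉ SE, A w = αP w := fun w hw => by
        rw [hα w hw, hz', Complex.cpow_zero]
        simp
      have hβ0 : ∀ w ∉ SE, A (c • w) = αP (c • w) := fun w hw => by
        rw [hβ w hw, hz', Complex.cpow_zero]
        simp
      have hne : P ≠ Pc.conj := by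
        intro he
        apply hπ
        have hconj : IsSatakeFamilyOf P SE fun w => (αP (c • w)).map (starRingEnd ℂ) := by
          rw [he]
          exact hβSE.conj
        have hinv : ∀ w ∉ SE, A (c • w) = (A w).map (·⁻¹) := by
          intro w hw
          obtain ⟨𝔫, h𝔫, hw𝔫, ϖ, hSat⟩ := hβSE w hw
          have h1 : αP w = (αP (c • w)).map (starRingEnd ℂ) := hαSE.eq_of_not_mem hconj hw hw
          have h2 : (αP (c • w)).map (fun a => (starRingEnd ℂ a)⁻¹) = αP (c • w) :=
            hSat.map_conj_inv_eq h𝔫 hw𝔫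
          rw [hβ0 w hw, hα0 w hw, h1, Multiset.map_map]
          exact h2.symm
        have hev : ∀ᶠ w : HeightOneSpectrum (𝓞 E) in cofinite, w ∉ SE := hSEfin.compl_mem_cofinite
        filter_upwards [hev] with w hw α β hαw hβw
        rw [π.1.hasSatakeParamAt_unique_holds hαw (hSA.hasSatakeParamAt (hunder w hw)),
          π.1.hasSatakeParamAt_unique_holds hβw (hSA.hasSatakeParamAt (hunderc w hw))]
        exact hinv w hw
      obtain ⟨r, hr, hT⟩ := (h22 μ) hN (hm1 μ) P Pc hne hSEfin hαSE hβSE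
      refine ⟨r, hr, ?_⟩
      have hR0 : partialPairL SE A (fun w => A (c • w)) =
          partialPairL SE αP (fun w => αP (c • w)) := by
        rw [hR]
        funext s
        rw [hz0, sub_zero]
      rw [hR0]
      exact hT
    · -- `z ≠ 0`: the boundary point `1 - 2z ≠ 1` of `Re s = 1`, `h22'`
      have hs₀ : ((1 : ℂ) - (z + z)).re = 1 := by rw [hre, Complex.one_re]
      have hs₁ : (1 : ℂ) - (z + z) ≠ 1 := fun h => hz0 (sub_eq_self.mp h)
      obtain ⟨r, hr, hT⟩ := (h22' μ) hN hN P Pc hSEfin hαSE hβSE hs₀ hs₁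
      exact ⟨r, hr, tendsto_partialPairL_of_shift' hα hβ hzz hT⟩

/-- **`L^{S_E}(s, Π × Π^c)` for `Π` conjugate self-dual: multipliable and holomorphic on
`{1 < Re s}`, simple pole at `s = 1` along `Re s → 1⁺`, at all large Asai data — from
Jacquet–Shalika's (2.3) in `L²`.** The theorem `exists_largeSet_pairL_of_L2` of
`AsaiSignContProofsL2` with Mœglin–Waldspurger's continuation replaced by what is needed at `s = 1`
only: holomorphy on `{1 < Re s}`, which is Jacquet–Shalika I, Thm. (5.3), a theorem of the tree
(`differentiableOn_partialPairL_of_isSatakeFamilyOf`), and multipliability on all of `{1 < Re s}`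
((2.1), `JacquetShalika1981_multipliable_partialPairL_holds`). Proof as there: off the places below
the dictionary set `S₁` (`t_{Π,w} = q_w^z t_{Π₀,w}`, Borel–Jacquet 5.7) and below the finite failure
set of `t_{Π,cw} = t_{Π,w}⁻¹`, every factor of `R` is the pair factor of `(Π₀, Π̄₀)`
(`t⁻¹ = t̄`, `IsSatakeFamilyOf.map_inv_eq_map_conj`; `q^z q^{-z} = 1`), to which `hJS` applies.
[cite: GrbacShahidi2015, proof of Thm. 4.3, p. 206] [cite: ArthurClozelAMS120, Ch. 3 §2 (2.3)]
[cite: BorelJacquetCorvallis1979, 5.7] -/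
theorem CuspidalAutomorphicRepData.exists_largeSet_pairL_pole_of_L2'
    (hJS : ∀ (μ : Measure (gl N E).automorphicQuotient) [(gl N E).IsAutomorphicMeasure μ],
      JacquetShalika1981_partialPairL_pole_of_eq_conj (n := N) (K := E) (μ := μ))
    {c : E ≃ₐ[F] E} (hN : 0 < N) (π : CuspidalAutomorphicRepData N E hcpt)
    (hπ : π.1.IsConjSelfDualAE c) :
    ∃ Sstar : Set (HeightOneSpectrum (𝓞 F)), Sstar.Finite ∧
      ∀ (S : Set (HeightOneSpectrum (𝓞 F))) (A : SatakeFamily E), Sstar ⊆ S →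
        π.1.IsAsaiDatum c S A →
        (∀ s : ℂ, 1 < s.re →
          Multipliable fun w : {w : HeightOneSpectrum (𝓞 E) // w.under (𝓞 F) ∉ S} =>
            ((satakePairPolynomial (A w.1) (A (c • w.1))).eval
              ((w.1.residueCard : ℂ) ^ (-s)))⁻¹) ∧
        DifferentiableOn ℂ
          (partialPairL {w : HeightOneSpectrum (𝓞 E) | w.under (𝓞 F) ∈ S} A (fun w => A (c • w)))
          {s : ℂ | 1 < s.re} ∧
        ∃ r : ℂ, r ≠ 0 ∧
          Tendsto (fun s => (s - 1) *
              partialPairL {w : HeightOneSpectrum (𝓞 E) | w.under (𝓞 F) ∈ S} A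
                (fun w => A (c • w)) s)
            (𝓝[{s : ℂ | 1 < s.re}] 1) (𝓝 r) := by
  classical
  haveI : NeZero N := ⟨hN.ne'⟩
  obtain ⟨μ, hμ⟩ := AdelicGroupData.exists_isAutomorphicMeasure_gl_holds (n := N) (K := E)
  haveI := hμ
  obtain ⟨z, P, S₁, αP, hS₁, hαP, hdict⟩ :=
    CuspidalAutomorphicRepData.exists_satake_eq_cpow_mul_L2_holds μ π
  -- the finite failure set of the almost-everywhere conjugate self-duality
  have hπ' : ∀ᶠ w : HeightOneSpectrum (𝓞 E) in cofinite, ∀ α β : Multiset ℂ,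
      π.1.HasSatakeParamAt w α → π.1.HasSatakeParamAt (c • w) β → β = α.map (·⁻¹) := hπ
  set B : Set (HeightOneSpectrum (𝓞 E)) := {w | ¬ ∀ α β : Multiset ℂ,
      π.1.HasSatakeParamAt w α → π.1.HasSatakeParamAt (c • w) β → β = α.map (·⁻¹)} with hB
  have hBfin : B.Finite := Filter.eventually_cofinite.mp hπ'
  refine ⟨(fun w : HeightOneSpectrum (𝓞 E) => w.under (𝓞 F)) '' (S₁ ∪ B), (hS₁.union hBfin).image _,
    fun S A hSstar hSA => ?_⟩
  set SE : Set (HeightOneSpectrum (𝓞 E)) := {w | w.under (𝓞 F) ∈ S} with hSE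
  have hSEfin : SE.Finite := finite_setOf_under_mem hSA.finite
  have hS₁SE : S₁ ⊆ SE := fun w hw => hSstar ⟨w, Or.inl hw, rfl⟩
  have hnotS₁ : ∀ w : HeightOneSpectrum (𝓞 E), w.under (𝓞 F) ∉ S → w ∉ S₁ :=
    fun w hw h => hw (hSstar ⟨w, Or.inl h, rfl⟩)
  have hgood : ∀ w : HeightOneSpectrum (𝓞 E), w.under (𝓞 F) ∉ S → ∀ α β : Multiset ℂ,
      π.1.HasSatakeParamAt w α → π.1.HasSatakeParamAt (c • w) β → β = α.map (·⁻¹) := by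
    intro w hw
    by_contra h
    exact hw (hSstar ⟨w, Or.inr h, rfl⟩)
  have hα' : IsSatakeFamilyOf P SE αP := hαP.mono hS₁SE
  have hβ' : IsSatakeFamilyOf P.conj SE fun w => (αP w).map (starRingEnd ℂ) := hα'.conj
  -- the pair factor of `(A, A ∘ c)` at `w ∉ S_E` is the pair factor of `(Π₀, Π̄₀)`
  have key : ∀ w : HeightOneSpectrum (𝓞 E), w.under (𝓞 F) ∉ S →
      satakePairPolynomial (A w) (A (c • w)) =
        satakePairPolynomial (αP w) ((αP w).map (starRingEnd ℂ)) := by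
    intro w hw
    have hwS₁ : w ∉ S₁ := hnotS₁ w hw
    have hcw : (c • w).under (𝓞 F) ∉ S := by rwa [HeightOneSpectrum.under_algEquiv_smul]
    have hAw : A w = (αP w).map (((w.residueCard : ℂ) ^ z) * ·) :=
      (hdict w hwS₁ (A w)).mp (hSA.hasSatakeParamAt hw)
    have hAcw : A (c • w) = (A w).map (·⁻¹) :=
      hgood w hw (A w) (A (c • w)) (hSA.hasSatakeParamAt hw) (hSA.hasSatakeParamAt hcw)
    have hinv : (αP w).map (·⁻¹) = (αP w).map (starRingEnd ℂ) := hαP.map_inv_eq_map_conj hwS₁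
    have hq0 : (w.residueCard : ℂ) ≠ 0 := by
      exact_mod_cast (zero_lt_one.trans w.one_lt_residueCard).ne'
    have hqz : (w.residueCard : ℂ) ^ z ≠ 0 := fun h =>
      hq0 ((Complex.cpow_eq_zero_iff _ _).mp h).1
    have hAcw' : A (c • w) =
        ((αP w).map (starRingEnd ℂ)).map (((w.residueCard : ℂ) ^ (-z)) * ·) := by
      rw [hAcw, hAw, ← hinv, Multiset.map_map, Multiset.map_map]
      refine Multiset.map_congr rfl fun x _ => ?_
      show ((w.residueCard : ℂ) ^ z * x)⁻¹ = (w.residueCard : ℂ) ^ (-z) * x⁻¹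
      rw [mul_inv, Complex.cpow_neg]
    rw [hAw, hAcw']
    exact satakePairPolynomial_map_mul_map_mul (by rw [Complex.cpow_neg, mul_inv_cancel₀ hqz]) _ _
  have hR : partialPairL SE A (fun w => A (c • w)) =
      partialPairL SE αP (fun w => (αP w).map (starRingEnd ℂ)) := by
    funext s
    unfold partialPairL
    exact tprod_congr fun w => by rw [key w.1 w.2]
  refine ⟨fun s hs => ?_, ?_, ?_⟩
  · exact (JacquetShalika1981_multipliable_partialPairL_holds P P.conj hα' hβ' hs).congr
      fun w => by rw [key w.1 w.2]
  · rw [hR]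
    exact differentiableOn_partialPairL_of_isSatakeFamilyOf P P.conj hα' hβ'
  · obtain ⟨r, hr, hT⟩ := (hJS μ) hN P P.conj (P.conj_conj).symm hSEfin hα' hβ'
    refine ⟨r, hr, ?_⟩
    rw [hR]
    exact hT

end RankinSelberg

/-! ### The named fact from holomorphy and the `L²` facts -/

section Reduction

open AdelicGroupData

variable {F E : Type} [Field F] [NumberField F] [Field E] [NumberField E] [Algebra F E]
  {N : ℕ} {hcpt : isCompact_glFiniteIntegralLevel N E}

/-- **The `s = 1` clause at ONE datum, from holomorphy at that datum and the Rankin–Selberg input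
there** — the body of `GrbacShahidi2015_partialAsaiL_at_one_of_holomorphy` for a single
`(Π, S, A)`: clause (i) by `exists_multipliable_asaiEulerFactors`, a common half-plane and ball for
both signs, the identity `(∗∗)` near `1⁺`, then `exists_continuation_partialAsaiL_at_one_of_pairL_pole`
(conjugate self-dual case, simple pole of `R`) or `…_of_pairL_finite` (otherwise, `R(1) ≠ 0` finite
and both continuations vanishing at `1`). [cite: GrbacShahidi2015, proof of Thm. 4.3, pp. 205–206,
Remark 4.4] [cite: ArthurClozelAMS120, Ch. 3 §2 (2.2)–(2.3)] -/
theorem CuspidalAutomorphicRepData.exists_clause_partialAsaiL_at_one_of_hol_of_pairL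
    (h2 : Module.finrank F E = 2) {c : E ≃ₐ[F] E} (hc : c ≠ 1) (π : CuspidalAutomorphicRepData N E hcpt)
    (hN : 0 < N) {S : Set (HeightOneSpectrum (𝓞 F))} {A : SatakeFamily E}
    (hSA : π.1.IsAsaiDatum c S A)
    (hHolπ : ∀ θ : ℤˣ, ∃ σ₀ : ℝ, 1 ≤ σ₀ ∧ ∃ δ : ℝ, 0 < δ ∧ ∃ G : ℂ → ℂ,
      DifferentiableOn ℂ G ({s : ℂ | 1 < s.re} ∪ Metric.ball 1 δ) ∧
      (∀ s : ℂ, σ₀ < s.re → G s = (s - 1) * partialAsaiL S c A θ s) ∧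
      (¬ π.1.IsConjSelfDualAE c → G 1 = 0))
    (hmulP : ∀ s : ℂ, 1 < s.re →
      Multipliable fun w : {w : HeightOneSpectrum (𝓞 E) // w.under (𝓞 F) ∉ S} =>
        ((satakePairPolynomial (A w.1) (A (c • w.1))).eval ((w.1.residueCard : ℂ) ^ (-s)))⁻¹)
    (hRhol : DifferentiableOn ℂ
      (partialPairL {w : HeightOneSpectrum (𝓞 E) | w.under (𝓞 F) ∈ S} A (fun w => A (c • w)))
      {s : ℂ | 1 < s.re})
    (hpole : π.1.IsConjSelfDualAE c → ∃ r : ℂ, r ≠ 0 ∧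
      Tendsto (fun s => (s - 1) *
          partialPairL {w : HeightOneSpectrum (𝓞 E) | w.under (𝓞 F) ∈ S} A (fun w => A (c • w)) s)
        (𝓝[{s : ℂ | 1 < s.re}] 1) (𝓝 r))
    (hfin : ¬ π.1.IsConjSelfDualAE c → ∃ r : ℂ, r ≠ 0 ∧
      Tendsto (partialPairL {w : HeightOneSpectrum (𝓞 E) | w.under (𝓞 F) ∈ S} A (fun w => A (c • w)))
        (𝓝[{s : ℂ | 1 < s.re}] 1) (𝓝 r))
    (η : ℤˣ) :
    ∃ σ₀ : ℝ, 1 ≤ σ₀ ∧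
      (∀ (θ : ℤˣ) (s : ℂ), σ₀ < s.re →
        Multipliable fun v : {v : HeightOneSpectrum (𝓞 F) // v ∉ S} =>
          ((asaiLocalPolynomial c A θ (placeAbove E v.1)).eval ((v.1.residueCard : ℂ) ^ (-s)))⁻¹) ∧
      ∃ (k : ℕ) (δ : ℝ) (G : ℂ → ℂ), k ≤ 1 ∧ 0 < δ ∧
        DifferentiableOn ℂ G ({s : ℂ | 1 < s.re} ∪ Metric.ball 1 δ) ∧
        (∀ s : ℂ, σ₀ < s.re → G s = (s - 1) ^ k * partialAsaiL S c A η s) ∧ G 1 ≠ 0 := by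
  obtain ⟨σ₁, hσ₁, hmulA⟩ := π.exists_multipliable_asaiEulerFactors h2 hN hSA
  obtain ⟨σp, _, δp, hδp, Gp, hGp, hGLp, hGp1⟩ := hHolπ 1
  obtain ⟨σm, _, δm, hδm, Gm, hGm, hGLm, hGm1⟩ := hHolπ (-1)
  -- common half-plane `{σ < Re s}` and common ball `B(1, δ)`
  set σ : ℝ := max σ₁ (max σp σm) with hσdef
  set δ : ℝ := min δp δm with hδdef
  have hδ : 0 < δ := lt_min hδp hδm
  have hσ₁σ : σ₁ ≤ σ := le_max_left _ _
  have hσ : 1 ≤ σ := hσ₁.trans hσ₁σ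
  have hσpσ : σp ≤ σ := (le_max_left _ _).trans (le_max_right _ _)
  have hσmσ : σm ≤ σ := (le_max_right _ _).trans (le_max_right _ _)
  have hUp : {s : ℂ | 1 < s.re} ∪ Metric.ball (1 : ℂ) δ ⊆ {s : ℂ | 1 < s.re} ∪ Metric.ball 1 δp :=
    Set.union_subset_union_right _ (Metric.ball_subset_ball (min_le_left _ _))
  have hUm : {s : ℂ | 1 < s.re} ∪ Metric.ball (1 : ℂ) δ ⊆ {s : ℂ | 1 < s.re} ∪ Metric.ball 1 δm :=
    Set.union_subset_union_right _ (Metric.ball_subset_ball (min_le_right _ _))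
  have hmulA' : ∀ (θ : ℤˣ) (s : ℂ), σ < s.re →
      Multipliable fun v : {v : HeightOneSpectrum (𝓞 F) // v ∉ S} =>
        ((asaiLocalPolynomial c A θ (placeAbove E v.1)).eval ((v.1.residueCard : ℂ) ^ (-s)))⁻¹ :=
    fun θ s hs => hmulA θ s (lt_of_le_of_lt hσ₁σ hs)
  have hmulP' : ∀ s : ℂ, σ < s.re →
      Multipliable fun w : {w : HeightOneSpectrum (𝓞 E) // w.under (𝓞 F) ∉ S} =>
        ((satakePairPolynomial (A w.1) (A (c • w.1))).eval ((w.1.residueCard : ℂ) ^ (-s)))⁻¹ :=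
    fun s hs => hmulP s (lt_of_le_of_lt hσ hs)
  have hGLp' : ∀ s : ℂ, σ < s.re → Gp s = (s - 1) * partialAsaiL S c A 1 s :=
    fun s hs => hGLp s (lt_of_le_of_lt hσpσ hs)
  have hGLm' : ∀ s : ℂ, σ < s.re → Gm s = (s - 1) * partialAsaiL S c A (-1) s :=
    fun s hs => hGLm s (lt_of_le_of_lt hσmσ hs)
  have hinert : ∀ w : HeightOneSpectrum (𝓞 E), w.under (𝓞 F) ∉ S → c • w = w →
      w.asIdeal.inertiaDeg (𝓞 F) = 2 := fun w hw hcw => hSA.inertiaDeg_eq_two hw hcw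
  have key : ∃ (k : ℕ) (δ' : ℝ) (G : ℂ → ℂ), k ≤ 1 ∧ 0 < δ' ∧
      DifferentiableOn ℂ G ({s : ℂ | 1 < s.re} ∪ Metric.ball 1 δ') ∧
      (∀ s : ℂ, σ < s.re → G s = (s - 1) ^ k * partialAsaiL S c A η s) ∧ G 1 ≠ 0 := by
    by_cases hcsd : π.1.IsConjSelfDualAE c
    · obtain ⟨r, hr, hr'⟩ := hpole hcsd
      exact exists_continuation_partialAsaiL_at_one_of_pairL_pole h2 hc hinert hσ hδ hmulA' hmulP'
        hRhol hr hr' (hGp.mono hUp) (hGm.mono hUm) hGLp' hGLm' η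
    · obtain ⟨r, hr, hr'⟩ := hfin hcsd
      exact exists_continuation_partialAsaiL_at_one_of_pairL_finite h2 hc hinert hσ hδ hmulA' hmulP'
        hRhol hr hr' (hGp.mono hUp) (hGm.mono hUm) hGLp' hGLm' (hGp1 hcsd) (hGm1 hcsd) η
  obtain ⟨k, δ', G, hk, hδ', hG, hGL, hG1⟩ := key
  exact ⟨σ, hσ, hmulA', k, δ', G, hk, hδ', hG, hGL, hG1⟩

omit [NumberField E] in
/-- **The `s = 1` clause goes down from an enlarged datum `(S'', A)`, `S ⊆ S''`, to `(S, A)`**,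
given holomorphy at `(S, A)` (a continuation `G` of `(s - 1) L^S(s, A, As^η)` to
`{1 < Re s} ∪ B(1, δ)`): far to the right `L^{S''} = Q · L^S` with
`Q(s) = ∏_{v ∈ S'' ∖ S} det(1 - As^η(t_v) q_v^{-s})` entire (`exists_forall_partialAsaiL_eq_prod_mul`,
`differentiable_eval_asaiLocalPolynomial_cpow`), and `exists_clause_of_eq_mul` applies. No hypothesis
on the values `Q(1)` is needed. [cite: GrbacShahidi2015, proof of Thm. 4.3, pp. 205–206] -/
theorem exists_clause_partialAsaiL_at_one_of_subset {S S'' : Set (HeightOneSpectrum (𝓞 F))}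
    (hSS'' : S ⊆ S'') (hfin : (S'' \ S).Finite) (c : E ≃ₐ[F] E) (A : SatakeFamily E) (η : ℤˣ)
    {σm : ℝ}
    (hmul'' : ∀ s : ℂ, σm < s.re →
      Multipliable fun v : {v : HeightOneSpectrum (𝓞 F) // v ∉ S''} =>
        ((asaiLocalPolynomial c A η (placeAbove E v.1)).eval ((v.1.residueCard : ℂ) ^ (-s)))⁻¹)
    {σ₀ δ : ℝ} (hσ₀ : 1 ≤ σ₀) (hδ : 0 < δ) {G : ℂ → ℂ}
    (hG : DifferentiableOn ℂ G ({s : ℂ | 1 < s.re} ∪ Metric.ball (1 : ℂ) δ))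
    (hGL : ∀ s : ℂ, σ₀ < s.re → G s = (s - 1) * partialAsaiL S c A η s)
    {σ'' δ'' : ℝ} {k'' : ℕ} {G'' : ℂ → ℂ} (hk'' : k'' ≤ 1) (hδ'' : 0 < δ'')
    (hG'' : DifferentiableOn ℂ G'' ({s : ℂ | 1 < s.re} ∪ Metric.ball (1 : ℂ) δ''))
    (hG''L : ∀ s : ℂ, σ'' < s.re → G'' s = (s - 1) ^ k'' * partialAsaiL S'' c A η s)
    (hG''1 : G'' 1 ≠ 0) :
    ∃ σ : ℝ, σ₀ ≤ σ ∧ ∃ (k : ℕ) (δ' : ℝ) (G' : ℂ → ℂ), k ≤ 1 ∧ 0 < δ' ∧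
      DifferentiableOn ℂ G' ({s : ℂ | 1 < s.re} ∪ Metric.ball 1 δ') ∧
      (∀ s : ℂ, σ < s.re → G' s = (s - 1) ^ k * partialAsaiL S c A η s) ∧ G' 1 ≠ 0 := by
  classical
  obtain ⟨σ', -, hprod⟩ := exists_forall_partialAsaiL_eq_prod_mul hSS'' hfin c A η hmul''
  set Q : ℂ → ℂ := fun s => ∏ v ∈ hfin.toFinset,
    (asaiLocalPolynomial c A η (placeAbove E v)).eval ((v.residueCard : ℂ) ^ (-s)) with hQ
  have hQd : Differentiable ℂ Q := Differentiable.fun_finsetProd fun v _ =>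
    differentiable_eval_asaiLocalPolynomial_cpow c A η (placeAbove E v)
      (zero_lt_one.trans v.one_lt_residueCard)
  set σ : ℝ := max σ₀ (max σ' σ'') with hσdef
  have hσ₀σ : σ₀ ≤ σ := le_max_left _ _
  have hσ'σ : σ' ≤ σ := (le_max_left _ _).trans (le_max_right _ _)
  have hσ''σ : σ'' ≤ σ := (le_max_right _ _).trans (le_max_right _ _)
  have hσ : 1 ≤ σ := hσ₀.trans hσ₀σ
  have hLL : ∀ s : ℂ, σ < s.re → partialAsaiL S'' c A η s = Q s * partialAsaiL S c A η s :=
    fun s hs => hprod s (lt_of_le_of_lt hσ'σ hs)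
  obtain ⟨k, δ', G', hk, hδ', hG', hG'L, hG'1⟩ := exists_clause_of_eq_mul hσ hδ hδ'' hQd hLL hG
    (fun s hs => hGL s (lt_of_le_of_lt hσ₀σ hs)) hk'' hG''
    (fun s hs => hG''L s (lt_of_le_of_lt hσ''σ hs)) hG''1
  exact ⟨σ, hσ₀σ, k, δ', G', hk, hδ', hG', hG'L, hG'1⟩

/-- **Grbac–Shahidi 2015, Thm. 4.3 at `s = 1` (the named fact `GrbacShahidi2015_partialAsaiL_at_one`)
from HOLOMORPHY and the `L²` facts of Jacquet–Shalika.** Hypotheses: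

* `hHol` — exactly as in `GrbacShahidi2015_partialAsaiL_at_one_of_holomorphy` (Grbac–Shahidi,
  Thm. 4.3 (1) "`L(s, σ, r_A)` is entire" and (2)(a) "entire, except for possible simple poles at
  `s = 0` and `s = 1`", holomorphy clauses, for the partial functions of a unitary cuspidal `Π` near
  `{Re s ≥ 1}`: a continuation `G` of `(s - 1) L^S(s, Π, As^η)` to `{1 < Re s} ∪ B(1, δ)`, vanishing
  at `1` unless `Π` is conjugate self-dual a.e.);
* `h22`, `h22'`, `h23`, `hm1` — the tree's NAMED FACTS `JacquetShalika1981_partialPairL_at_one_of_ne_conj`,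
  `JacquetShalika1981_partialPairL_boundary_of_ne_one` (equal ranks, one measure),
  `JacquetShalika1981_partialPairL_pole_of_eq_conj` (Arthur–Clozel, Ch. 3, (2.2)–(2.3) in `L²_cusp`)
  and `multiplicity_one_gl`, over every number field, in every rank, for every automorphic measure.

Proof. For `Π` fixed the Rankin–Selberg input holds at all data `S ⊇ S⋆(Π)`
(`exists_largeSet_pairL_pole_of_L2'` if `Π` is conjugate self-dual a.e.,
`exists_largeSet_pairL_finite_of_L2` otherwise), so the clause holds at `(S ∪ S⋆, A)`
(`exists_clause_partialAsaiL_at_one_of_hol_of_pairL`) and goes down to `(S, A)`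
(`exists_clause_partialAsaiL_at_one_of_subset`, with the continuation at `S` from `hHol`); clause (i)
is `exists_multipliable_asaiEulerFactors`. Compared with `…_of_holomorphy` the hypothesis `hRS` is
gone: what the tree lacks for the fact is `hHol` and the discharge of the four named facts.
[cite: GrbacShahidi2015, Thm. 4.3 and its proof, pp. 204–206, Remarks 4.2, 4.4]
[cite: ArthurClozelAMS120, Ch. 3 §2 (2.1)–(2.3)] [cite: BorelJacquetCorvallis1979, 5.7] -/
theorem GrbacShahidi2015_partialAsaiL_at_one_of_holomorphy_of_L2
    (hHol : ∀ (F E : Type) [Field F] [NumberField F] [Field E] [NumberField E] [Algebra F E]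
      (c : E ≃ₐ[F] E), Module.finrank F E = 2 → c ≠ 1 →
      ∀ (N : ℕ) (hcpt : isCompact_glFiniteIntegralLevel N E)
        (π : CuspidalAutomorphicRepData N E hcpt), 0 < N →
        (∀ᶠ w : HeightOneSpectrum (𝓞 E) in cofinite, ∀ α : Multiset ℂ,
          π.1.HasSatakeParamAt w α → ‖α.prod‖ = 1) →
        ∀ (S : Set (HeightOneSpectrum (𝓞 F))) (A : SatakeFamily E) (η : ℤˣ),
          π.1.IsAsaiDatum c S A →
          ∃ σ₀ : ℝ, 1 ≤ σ₀ ∧ ∃ δ : ℝ, 0 < δ ∧ ∃ G : ℂ → ℂ,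
            DifferentiableOn ℂ G ({s : ℂ | 1 < s.re} ∪ Metric.ball 1 δ) ∧
            (∀ s : ℂ, σ₀ < s.re → G s = (s - 1) * partialAsaiL S c A η s) ∧
            (¬ π.1.IsConjSelfDualAE c → G 1 = 0))
    (h22 : ∀ (E : Type) [Field E] [NumberField E] (N : ℕ)
      (μ : Measure (gl N E).automorphicQuotient) [(gl N E).IsAutomorphicMeasure μ],
      JacquetShalika1981_partialPairL_at_one_of_ne_conj (n := N) (K := E) (μ := μ))
    (h22' : ∀ (E : Type) [Field E] [NumberField E] (N : ℕ)
      (μ : Measure (gl N E).automorphicQuotient) [(gl N E).IsAutomorphicMeasure μ],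
      JacquetShalika1981_partialPairL_boundary_of_ne_one (n := N) (m := N) (K := E) (μ := μ)
        (μ' := μ))
    (h23 : ∀ (E : Type) [Field E] [NumberField E] (N : ℕ)
      (μ : Measure (gl N E).automorphicQuotient) [(gl N E).IsAutomorphicMeasure μ],
      JacquetShalika1981_partialPairL_pole_of_eq_conj (n := N) (K := E) (μ := μ))
    (hm1 : ∀ (E : Type) [Field E] [NumberField E] (N : ℕ)
      (μ : Measure (gl N E).automorphicQuotient) [(gl N E).IsAutomorphicMeasure μ],
      multiplicity_one_gl N E μ) :
    GrbacShahidi2015_partialAsaiL_at_one := by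
  intro F E _ _ _ _ _ c h2 hc N hcpt π hN hu S A η hSA
  classical
  have hcc : c * c = 1 := AlgEquiv.mul_self_eq_one_of_finrank_eq_two h2 c
  -- the Rankin–Selberg input at all large data of `π`
  obtain ⟨Sstar, hSstar, hlarge⟩ : ∃ Sstar : Set (HeightOneSpectrum (𝓞 F)), Sstar.Finite ∧
      ∀ (S : Set (HeightOneSpectrum (𝓞 F))) (A : SatakeFamily E), Sstar ⊆ S →
        π.1.IsAsaiDatum c S A →
        (∀ s : ℂ, 1 < s.re →
          Multipliable fun w : {w : HeightOneSpectrum (𝓞 E) // w.under (𝓞 F) ∉ S} =>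
            ((satakePairPolynomial (A w.1) (A (c • w.1))).eval
              ((w.1.residueCard : ℂ) ^ (-s)))⁻¹) ∧
        DifferentiableOn ℂ
          (partialPairL {w : HeightOneSpectrum (𝓞 E) | w.under (𝓞 F) ∈ S} A (fun w => A (c • w)))
          {s : ℂ | 1 < s.re} ∧
        (π.1.IsConjSelfDualAE c → ∃ r : ℂ, r ≠ 0 ∧
          Tendsto (fun s => (s - 1) *
              partialPairL {w : HeightOneSpectrum (𝓞 E) | w.under (𝓞 F) ∈ S} A
                (fun w => A (c • w)) s)
            (𝓝[{s : ℂ | 1 < s.re}] 1) (𝓝 r)) ∧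
        (¬ π.1.IsConjSelfDualAE c → ∃ r : ℂ, r ≠ 0 ∧
          Tendsto
            (partialPairL {w : HeightOneSpectrum (𝓞 E) | w.under (𝓞 F) ∈ S} A (fun w => A (c • w)))
            (𝓝[{s : ℂ | 1 < s.re}] 1) (𝓝 r)) := by
    by_cases hπ : π.1.IsConjSelfDualAE c
    · obtain ⟨Sstar, hSstar, h⟩ := π.exists_largeSet_pairL_pole_of_L2' (h23 E N) hN hπ
      refine ⟨Sstar, hSstar, fun S A hSS hSA => ?_⟩
      obtain ⟨hm, hd, hp⟩ := h S A hSS hSA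
      exact ⟨hm, hd, fun _ => hp, fun hn => absurd hπ hn⟩
    · obtain ⟨Sstar, hSstar, h⟩ :=
        π.exists_largeSet_pairL_finite_of_L2 (h22 E N) (h22' E N) (hm1 E N) hcc hN hu hπ
      refine ⟨Sstar, hSstar, fun S A hSS hSA => ?_⟩
      obtain ⟨hm, hd, hf⟩ := h S A hSS hSA
      exact ⟨hm, hd, fun hp => absurd hp hπ, fun _ => hf⟩
  -- the clause at the enlarged datum `(S ∪ S⋆, A)`
  have hS''fin : (S ∪ Sstar).Finite := hSA.finite.union hSstar
  have hSA'' : π.1.IsAsaiDatum c (S ∪ Sstar) A := hSA.mono Set.subset_union_left hS''fin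
  have hdiff : ((S ∪ Sstar) \ S).Finite := hS''fin.subset fun _ hv => hv.1
  obtain ⟨hmulP, hRhol, hpole, hfin⟩ := hlarge (S ∪ Sstar) A Set.subset_union_right hSA''
  obtain ⟨σ'', -, hmulA'', k'', δ'', G'', hk'', hδ'', hG'', hG''L, hG''1⟩ :=
    π.exists_clause_partialAsaiL_at_one_of_hol_of_pairL h2 hc hN hSA''
      (fun θ => hHol F E c h2 hc N hcpt π hN hu (S ∪ Sstar) A θ hSA'') hmulP hRhol hpole hfin η
  -- down to `(S, A)`: clause (i) at `S`, holomorphy at `S`, transport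
  obtain ⟨σ₁, hσ₁, hmulA⟩ := π.exists_multipliable_asaiEulerFactors h2 hN hSA
  obtain ⟨σS, hσS, δS, hδS, GS, hGS, hGSL, -⟩ := hHol F E c h2 hc N hcpt π hN hu S A η hSA
  obtain ⟨σ, hσSσ, k, δ', G', hk, hδ', hG', hG'L, hG'1⟩ :=
    exists_clause_partialAsaiL_at_one_of_subset Set.subset_union_left hdiff c A η (hmulA'' η) hσS
      hδS hGS hGSL hk'' hδ'' hG'' hG''L hG''1
  refine ⟨max σ σ₁, hσS.trans (hσSσ.trans (le_max_left _ _)),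
    fun s hs => hmulA η s (lt_of_le_of_lt (le_max_right _ _) hs), k, δ', G', hk, hδ', hG',
    fun s hs => hG'L s (lt_of_le_of_lt (le_max_left _ _) hs), hG'1⟩

/-- **The same with Mok's dichotomy feeding the conjugate self-dual stratum of `hHol`**
(`hol_of_Mok2014_partialAsaiL_continuation_pole_dichotomy`): granted the named facts
`Mok2014_partialAsaiL_continuation_pole_dichotomy` (Grbac–Shahidi Thm. 4.3 (2) in Mok's currency),
`JacquetShalika1981_partialPairL_{at_one_of_ne_conj, boundary_of_ne_one, pole_of_eq_conj}` and
`multiplicity_one_gl`, the fact `GrbacShahidi2015_partialAsaiL_at_one` follows from its one remaining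
analytic input `hHolnc` — **Grbac–Shahidi, Thm. 4.3 (1), holomorphy at `s = 1`, partial form**: for
`[E : F] = 2`, `c ≠ 1`, a cuspidal `Π` on `GL_N(𝔸_E)` (`N ≥ 1`) unitary a.e. and NOT conjugate
self-dual a.e., an Asai datum `(S, A)` and a sign `η`, the function `(s - 1) L^S(s, Π, As^η)`
continues holomorphically from some `{σ₀ < Re s}` to `{1 < Re s} ∪ B(1, δ)` with value `0` at `1`
(i.e. `L^S(s, Π, As^η)` is holomorphic at `s = 1` and on `{1 < Re s}`; in print: "Suppose `σ` is not
Galois self-dual … Then `L(s, σ, r_A)` is entire", applied to the unitary normalisation `σ` of `Π`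
and to `σ ⊗ δ̂`, at the point `1 + 2it₀`, `Π = σ ⊗ |det|^{it₀}` — or, when `σ` IS Galois self-dual
but `t₀ ≠ 0`, Thm. 4.3 (2)(a) off the poles `0, 1`). This is the only hypothesis below that is not a
declaration of the tree. [cite: GrbacShahidi2015, Thm. 4.3 (1), (2)(a), pp. 186, 204]
[cite: Mok2014, §2.5 and Thm. 2.5.4 (a)] [cite: ArthurClozelAMS120, Ch. 3 §2 (2.2)–(2.3)] -/
theorem GrbacShahidi2015_partialAsaiL_at_one_of_Mok_of_L2
    (hMok : Mok2014_partialAsaiL_continuation_pole_dichotomy)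
    (hHolnc : ∀ (F E : Type) [Field F] [NumberField F] [Field E] [NumberField E] [Algebra F E]
      (c : E ≃ₐ[F] E), Module.finrank F E = 2 → c ≠ 1 →
      ∀ (N : ℕ) (hcpt : isCompact_glFiniteIntegralLevel N E)
        (π : CuspidalAutomorphicRepData N E hcpt), 0 < N →
        (∀ᶠ w : HeightOneSpectrum (𝓞 E) in cofinite, ∀ α : Multiset ℂ,
          π.1.HasSatakeParamAt w α → ‖α.prod‖ = 1) →
        ¬ π.1.IsConjSelfDualAE c →
        ∀ (S : Set (HeightOneSpectrum (𝓞 F))) (A : SatakeFamily E) (η : ℤˣ),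
          π.1.IsAsaiDatum c S A →
          ∃ σ₀ : ℝ, 1 ≤ σ₀ ∧ ∃ δ : ℝ, 0 < δ ∧ ∃ G : ℂ → ℂ,
            DifferentiableOn ℂ G ({s : ℂ | 1 < s.re} ∪ Metric.ball 1 δ) ∧
            (∀ s : ℂ, σ₀ < s.re → G s = (s - 1) * partialAsaiL S c A η s) ∧ G 1 = 0)
    (h22 : ∀ (E : Type) [Field E] [NumberField E] (N : ℕ)
      (μ : Measure (gl N E).automorphicQuotient) [(gl N E).IsAutomorphicMeasure μ],
      JacquetShalika1981_partialPairL_at_one_of_ne_conj (n := N) (K := E) (μ := μ))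
    (h22' : ∀ (E : Type) [Field E] [NumberField E] (N : ℕ)
      (μ : Measure (gl N E).automorphicQuotient) [(gl N E).IsAutomorphicMeasure μ],
      JacquetShalika1981_partialPairL_boundary_of_ne_one (n := N) (m := N) (K := E) (μ := μ)
        (μ' := μ))
    (h23 : ∀ (E : Type) [Field E] [NumberField E] (N : ℕ)
      (μ : Measure (gl N E).automorphicQuotient) [(gl N E).IsAutomorphicMeasure μ],
      JacquetShalika1981_partialPairL_pole_of_eq_conj (n := N) (K := E) (μ := μ))
    (hm1 : ∀ (E : Type) [Field E] [NumberField E] (N : ℕ)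
      (μ : Measure (gl N E).automorphicQuotient) [(gl N E).IsAutomorphicMeasure μ],
      multiplicity_one_gl N E μ) :
    GrbacShahidi2015_partialAsaiL_at_one := by
  refine GrbacShahidi2015_partialAsaiL_at_one_of_holomorphy_of_L2 ?_ h22 h22' h23 hm1
  intro F E _ _ _ _ _ c h2 hc N hcpt π hN hu S A η hSA
  by_cases hπ : π.1.IsConjSelfDualAE c
  · exact hol_of_Mok2014_partialAsaiL_continuation_pole_dichotomy hMok h2 hc π hN hπ η hSA
  · obtain ⟨σ₀, hσ₀, δ, hδ, G, hG, hGL, hG1⟩ := hHolnc F E c h2 hc N hcpt π hN hu hπ S A η hSA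
    exact ⟨σ₀, hσ₀, δ, hδ, G, hG, hGL, fun _ => hG1⟩

end Reduction

end Literature.NumberTheory.Automorphic

end
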